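import Summits.ValiantsHypothesis.ValiantsHypothesis.Theorems.SymPencilPerFourInnerRankTenFamily
import Summits.ValiantsHypothesis.ValiantsHypothesis.Theorems.SymPencilPerFourInnerRankKernelVectors
import Summits.ValiantsHypothesis.ValiantsHypothesis.Theorems.SymPencilPerFourInnerRankIsotropicCone

/-!
# Route `SymPencil` — inner rank of the `2 | 2` row split of `per_4`: the kernel of the
# `a`-slot is a `≥ 3`-dimensional subspace of the common isotropic cone (`|ι| ≤ 11`)
# (`--supports` stmt-ValiantsHypothesis-5674 `SdcSuperquadratic`; (8,8) column of the size tables)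

For a joint family `Σ_r c_r t_r((a,b),(y₂,y₃))² = per (a; b; y₂; y₃)` with non-zero weights, and a
fixed `a ∈ K⁴`, let `K_a := ker (y ↦ (t_r((a,0),y))_r) ≤ K⁴ × K⁴` (the kernel of the `a`-slot).

* `slotA_isotropic`: the image of `y ↦ (t_r((a,0),y))_r` is totally isotropic for
  `⟨x,z⟩ = Σ c_r x_r z_r` (the identity at `b = 0` has right-hand side `per (a; 0; ·; ·) = 0`);
* `three_le_finrank_ker_slotA`: hence, if `|ι| ≤ 11`, `dim K_a ≥ 3` (an isotropic subspace of the
  non-degenerate `K^ι` has dimension `≤ |ι|/2 ≤ 5`, and `8 - 5 = 3`);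
* `ker_slotA_cone`: `K_a` lies in the common isotropic cone at `a`:
  `per (a; e_l; y₂; y₃) = 0` for `(y₂,y₃) ∈ K_a` and every `l`;
* `slotA_dichotomies`: consequently, for `a` with non-zero coordinates, the five dichotomies of
  `SymPencilPerFourInnerRankIsotropicCone.cone_dichotomies_diag` hold on `K_a`.

This is step (1) of the isotropic-kernel route to the cells `(8,8,10)`, `(8,8,11)` (memo
`NOTE-p6g15-5674-IR12-reduction.md` on the item, §2); the other three slots (`b`, `y₂`, `y₃`)
follow by the symmetries `a ↔ b`, `(a,b) ↔ (y₂,y₃)` of the problem.  Honest framing: a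
conditional reduction step; the cells stay open; the window `27 ≤ sdc(per_4) ≤ 29`, the crux and
`VP ≠ VNP` are untouched.  No definitions, no named facts. [folklore]
-/

noncomputable section

-- single-conjunct layout: Sub = Summit, duplicated namespace component intended
set_option linter.dupNamespace false

namespace Summit.ValiantsHypothesis.ValiantsHypothesis.Theorems.SymPencilPerFourInnerRankSlotKernel

open Matrix Finset Module
open Summit.ValiantsHypothesis.ValiantsHypothesis.Theorems.SymPencilPerFourInnerRankRows
open Summit.ValiantsHypothesis.ValiantsHypothesis.Theorems.SymPencilPerFourInnerRankTenFamily
open Summit.ValiantsHypothesis.ValiantsHypothesis.Theorems.SymPencilPerFourInnerRankKernelVectors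
open Summit.ValiantsHypothesis.ValiantsHypothesis.Theorems.SymPencilPerFourInnerRankIsotropicCone

variable {K : Type*} [Field K] {ι : Type*} [Fintype ι]

/-- **The `a`-slot is isotropic**: `Σ_r c_r t_r((a,0),y) t_r((a,0),y') = 0`. [folklore] -/
theorem slotA_isotropic [CharZero K] (c : ι → K)
    (t : ι → (((Fin 4 → K) × (Fin 4 → K)) →ₗ[K] ((Fin 4 → K) × (Fin 4 → K)) →ₗ[K] K))
    (hJ : ∀ a b y₂ y₃ : Fin 4 → K,
      ∑ r, c r * (t r (a, b) (y₂, y₃)) ^ 2 = (Matrix.of ![a, b, y₂, y₃]).permanent)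
    (a : Fin 4 → K) (y y' : (Fin 4 → K) × (Fin 4 → K)) :
    ∑ r, c r * t r (a, 0) y * t r (a, 0) y' = 0 := by
  have h := polar c t hJ a 0 y.1 y.2 y'.1 y'.2
  rw [← per_swap_row₀₁ a 0, per_zero_row₀, ← per_swap_row₀₁ a 0, per_zero_row₀, add_zero] at h
  simpa using h

/-- **The kernel of the `a`-slot has dimension `≥ 3`** when `|ι| ≤ 11` and all weights are
non-zero. [folklore] -/
theorem three_le_finrank_ker_slotA [CharZero K] [DecidableEq ι] (hι : Fintype.card ι ≤ 11)
    (c : ι → K) (hc : ∀ r, c r ≠ 0)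
    (t : ι → (((Fin 4 → K) × (Fin 4 → K)) →ₗ[K] ((Fin 4 → K) × (Fin 4 → K)) →ₗ[K] K))
    (hJ : ∀ a b y₂ y₃ : Fin 4 → K,
      ∑ r, c r * (t r (a, b) (y₂, y₃)) ^ 2 = (Matrix.of ![a, b, y₂, y₃]).permanent)
    (a : Fin 4 → K) :
    3 ≤ finrank K (LinearMap.ker (LinearMap.pi fun r => t r (a, 0))) := by
  obtain ⟨B, hB⟩ := exists_bilinForm_weighted (K := K) c
  set Ta : ((Fin 4 → K) × (Fin 4 → K)) →ₗ[K] (ι → K) := LinearMap.pi fun r => t r (a, 0)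
    with hTa_def
  have hTa : ∀ y r, Ta y r = t r (a, 0) y := fun y r => rfl
  -- the image is totally isotropic
  have hiso : LinearMap.range Ta ≤ B.orthogonal (LinearMap.range Ta) := by
    rintro _ ⟨y, rfl⟩
    rw [LinearMap.BilinForm.mem_orthogonal_iff]
    rintro _ ⟨y', rfl⟩
    change B _ _ = 0
    rw [hB, ← slotA_isotropic c t hJ a y' y]
    exact Finset.sum_congr rfl fun r _ => by rw [hTa, hTa]
  have h1 := Submodule.finrank_mono hiso
  rw [LinearMap.BilinForm.finrank_orthogonal (nondegenerate_weighted c hc B hB),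
    finrank_fintype_fun_eq_card] at h1
  have h2 := LinearMap.finrank_range_add_finrank_ker Ta
  rw [finrank_prod, finrank_fintype_fun_eq_card, Fintype.card_fin] at h2
  have h3 : finrank K (LinearMap.range Ta) ≤ Fintype.card ι := by
    have h := Submodule.finrank_le (LinearMap.range Ta)
    rwa [finrank_fintype_fun_eq_card] at h
  omega

/-- **The kernel of the `a`-slot lies in the common isotropic cone at `a`**:
`per (a; e_l; y₂; y₃) = 0` for every `(y₂,y₃)` killed by all `t_r((a,0), ·)`. [folklore] -/
theorem ker_slotA_cone (c : ι → K)
    (t : ι → (((Fin 4 → K) × (Fin 4 → K)) →ₗ[K] ((Fin 4 → K) × (Fin 4 → K)) →ₗ[K] K))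
    (hJ : ∀ a b y₂ y₃ : Fin 4 → K,
      ∑ r, c r * (t r (a, b) (y₂, y₃)) ^ 2 = (Matrix.of ![a, b, y₂, y₃]).permanent)
    (a : Fin 4 → K) (y : (Fin 4 → K) × (Fin 4 → K))
    (hy : y ∈ LinearMap.ker (LinearMap.pi fun r => t r (a, 0))) (l : Fin 4) :
    (Matrix.of ![a, Pi.single l 1, y.1, y.2]).permanent = 0 := by
  have hy' : ∀ r, t r (a, 0) y = 0 := fun r => by
    have h := LinearMap.mem_ker.1 hy
    exact congr_fun h r
  have hsplit : ∀ r, t r (a, Pi.single l 1) y = t r (0, Pi.single l 1) y := fun r => by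
    have : ((a, Pi.single l 1) : (Fin 4 → K) × (Fin 4 → K)) = (a, 0) + (0, Pi.single l 1) := by
      simp
    rw [this, map_add, LinearMap.add_apply, hy' r, zero_add]
  have h1 := hJ a (Pi.single l 1) y.1 y.2
  have h2 := hJ 0 (Pi.single l 1) y.1 y.2
  rw [per_zero_row₀] at h2
  simp_rw [Prod.mk.eta, hsplit] at h1
  rw [Prod.mk.eta] at h2
  rw [← h1, h2]

/-- **The five dichotomies on the `a`-slot kernel** (`|ι| ≤ 11`, non-zero weights, `a` with
non-zero coordinates): in the rescaled coordinates `y₂ i / a i`, `y₃ i / a i`, either `Σ y₂ ≡ 0` or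
`Σ y₃ ≡ 0` on `K_a`, and for each `l` either `2 (y₂)_l ≡ Σ y₂` or `2 (y₃)_l ≡ Σ y₃` on `K_a`.
[folklore] -/
theorem slotA_dichotomies [CharZero K] [DecidableEq ι] (hι : Fintype.card ι ≤ 11)
    (c : ι → K) (hc : ∀ r, c r ≠ 0)
    (t : ι → (((Fin 4 → K) × (Fin 4 → K)) →ₗ[K] ((Fin 4 → K) × (Fin 4 → K)) →ₗ[K] K))
    (hJ : ∀ a b y₂ y₃ : Fin 4 → K,
      ∑ r, c r * (t r (a, b) (y₂, y₃)) ^ 2 = (Matrix.of ![a, b, y₂, y₃]).permanent)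
    (a : Fin 4 → K) (ha : ∀ i, a i ≠ 0) :
    ((∀ w ∈ LinearMap.ker (LinearMap.pi fun r => t r (a, 0)),
        w.1 0 / a 0 + w.1 1 / a 1 + w.1 2 / a 2 + w.1 3 / a 3 = 0) ∨
      (∀ w ∈ LinearMap.ker (LinearMap.pi fun r => t r (a, 0)),
        w.2 0 / a 0 + w.2 1 / a 1 + w.2 2 / a 2 + w.2 3 / a 3 = 0)) ∧
    ∀ l : Fin 4,
      (∀ w ∈ LinearMap.ker (LinearMap.pi fun r => t r (a, 0)),
        2 * (w.1 l / a l) = w.1 0 / a 0 + w.1 1 / a 1 + w.1 2 / a 2 + w.1 3 / a 3) ∨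
      (∀ w ∈ LinearMap.ker (LinearMap.pi fun r => t r (a, 0)),
        2 * (w.2 l / a l) = w.2 0 / a 0 + w.2 1 / a 1 + w.2 2 / a 2 + w.2 3 / a 3) :=
  cone_dichotomies_diag a ha _ (fun w hw l => ker_slotA_cone c t hJ a w hw l)
    (three_le_finrank_ker_slotA hι c hc t hJ a)

end Summit.ValiantsHypothesis.ValiantsHypothesis.Theorems.SymPencilPerFourInnerRankSlotKernel

end
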